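import Summits.BirchSwinnertonDyer.BirchSwinnertonDyer.Theorems.GenusKolyvaginAtTwoGenusPrimitiveSupplyAtTwoTwistLocalConditionSigned
import Summits.BirchSwinnertonDyer.Rank1Residual.X11b.PropagatedUnramified
import HarnessLib

/-!
# Route `GenusKolyvaginAtTwo`, crux #2 `GenusPrimitiveSupplyAtTwo` (stmt-BirchSwinnertonDyer-22136):
# towards Mazur–Rubin Lemma 2.11 — at a good odd place RAMIFIED in `K(√d)`: an inertia element negating `ι(√d)`,
# inertia fixes the local `4`-torsion of `E`, and the twist `E^{(d)}` has NO `K_v`-rational point of order `4`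

Width seat `bsd-line-gk2-p5` g8 (cell `bsd-f1-sign2`, SUPPLY lineage), seventh file of the series (crux workfile
`Lines/genus-supply-mr-instantiation.md`). THEOREMS ONLY (no definition, no named fact, no `sorry`); helper
`--supports stmt-BirchSwinnertonDyer-22136`; no item is closed; BSD is not proved by any of this.

WHY. The last local input of the cor34i-DOWN instance for twists (`natCard_selmerGroup_twist_mul_two_eq_of_local`, p620693)
is the TRANSVERSALITY `htr` at the ramified twisting prime — Mazur–Rubin 2010 Lemma 2.11. Its proof (this file = first
half): let `E = K_v`, `v ∤ 2`, `W` good at `v`, and `ι(√d) ∉ K_v^{nr}` (ramified). Then (§17) some `τ₀` in the inertia group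
`I_{K_v}` (`absInertia`, the fixator of `K_v^{nr}`, X11b `mem_absInertia_iff_forall_mem_maxUnramified`) maps `ι(√d) ↦ −ι(√d)`
(Krull–Galois correspondence `InfiniteGalois.fixedField_fixingSubgroup` + `ι(√d)² = d`); (§18) `I_{K_v}` fixes every point of
`W(K̄_v)[4]` (X11b `restrictField_torsionGaloisModule_apply_of_mem_absInertia`, Silverman VII.4.1, transported along
`torsionPointsEquiv`); (§19) hence a `Γ_{K_v}`-FIXED point `Q` of `Wd(K̄_v)` with `4Q = 0` has `2Q = 0`: by the signed untwisting
(p620927) `R = θ_E(Q) ∈ W(K̄_v)[4]` satisfies `χ(σ) σR = R`, and at `τ₀`: `R = τ₀ R = −R`. So `E^{(d)}(K_v)[2^∞] = E^{(d)}(K_v)[2]` —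
the input that makes `E^{(d)}(K_v)/2` the bijective image of its `2`-torsion (Mazur–Rubin's proof of Lemma 2.11).

References: [MazurRubin2010] Lemma 2.11; [SilvermanAEC2009] VII.4.1, X.5 Cor. 5.4; [SerreLocalFields1979] IV §1–§2.
-/

set_option linter.dupNamespace false -- tree convention: `Summit.BirchSwinnertonDyer.BirchSwinnertonDyer.Theorems` (summit = sub-problem)
set_option autoImplicit false

noncomputable section

open scoped Classical

namespace Summit.BirchSwinnertonDyer.BirchSwinnertonDyer.Theorems.GenusKolyTwistLocal

open WeierstrassCurve Field NumberField IsDedekindDomain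
open Literature.NumberTheory.EllipticCurves Literature.NumberTheory.GaloisRepresentations
open Literature.NumberTheory.GaloisRepresentations.IsNonarchimedeanLocalField
open Summit.BirchSwinnertonDyer.Rank1Residual.X11b

variable {K : Type} [Field K] [NumberField K] (W Wd : WeierstrassCurve K) (v : HeightOneSpectrum (𝓞 K))

/-! ## §17 An inertia element negating `ι(√d)` at a ramified place -/

omit W Wd in
/-- **At a place RAMIFIED in `K(√d)` some inertia element negates `ι(√d)`**: if `x ∈ K̄_v` with `x² = d` does not lie in the
maximal unramified extension `K_v^{nr}`, there is `τ₀ ∈ I_{K_v}` (the fixator of `K_v^{nr}`) with `τ₀ x = −x` (Krull–Galois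
correspondence for `K_v^{nr}/K_v` and `(τ₀ x)² = d`). [cite: SerreLocalFields1979, IV §1 (the inertia group)] -/
theorem exists_mem_absInertia_smul_eq_neg {d : K} {x : AlgebraicClosure (v.adicCompletion K)}
    (hx2 : x ^ 2 = algebraMap K (AlgebraicClosure (v.adicCompletion K)) d)
    (hx : x ∉ maxUnramified (v.adicCompletion K)) :
    ∃ τ₀ ∈ absInertia (v.adicCompletion K), τ₀ • x = -x := by
  haveI : CharZero (v.adicCompletion K) := Literature.NumberTheory.GaloisRepresentations.charZero_adicCompletion v
  haveI : IsGalois (v.adicCompletion K) (AlgebraicClosure (v.adicCompletion K)) := IsGalois.mk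
  have hx' : x ∉ IntermediateField.fixedField (maxUnramified (v.adicCompletion K)).fixingSubgroup := by
    rwa [InfiniteGalois.fixedField_fixingSubgroup]
  rw [IntermediateField.mem_fixedField_iff] at hx'
  push Not at hx'
  obtain ⟨f, hf, hfx⟩ := hx'
  refine ⟨(absoluteGaloisGroup.toAlgEquiv (v.adicCompletion K)).symm f, ?_, ?_⟩
  · rw [mem_absInertia_iff_forall_mem_maxUnramified]
    intro y hy
    have h := (mem_fixingSubgroup_iff _).mp hf y hy
    simpa using h
  · have hsq : (f x) ^ 2 = x ^ 2 := by
      rw [← map_pow, hx2, IsScalarTower.algebraMap_apply K (v.adicCompletion K) (AlgebraicClosure _),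
        AlgEquiv.commutes]
    rcases sq_eq_sq_iff_eq_or_eq_neg.mp hsq with h | h
    · exact absurd h hfx
    · simpa using h

/-! ## §18 Inertia fixes the local `2`-power torsion of a curve with good reduction at `v ∤ 2` -/

omit Wd in
/-- **`I_{K_v}` acts trivially on `W(K̄_v)[2^k]` at a good `v ∤ 2`** (Silverman VII.4.1: the `2^k`-torsion is unramified; X11b's
`restrictField_torsionGaloisModule_apply_of_mem_absInertia` on `E[2^k](K̄)`, transported to the local points along the tree's
`torsionPointsEquiv`). [cite: SilvermanAEC2009, Prop. VII.4.1(a)] -/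
theorem smul_eq_self_of_mem_absInertia_of_zsmul_eq_zero [W.IsElliptic] (hv : W.HasGoodReductionAt v)
    (h2v : ((2 : ℕ) : 𝓞 K) ∉ v.asIdeal) (k : ℕ) {τ : absoluteGaloisGroup (v.adicCompletion K)}
    (hτ : τ ∈ absInertia (v.adicCompletion K)) {R : localPoints W (v.adicCompletion K)}
    (hR : ((2 ^ k : ℕ) : ℤ) • R = 0) : τ • R = R := by
  have hn : ((2 ^ k : ℕ) : ℤ) ≠ 0 := by exact_mod_cast pow_ne_zero k two_ne_zero
  set T : AddSubgroup.torsionBy (localPoints W (v.adicCompletion K)) ((2 ^ k : ℕ) : ℤ) :=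
    ⟨R, (Submodule.mem_torsionBy_iff _ _).mpr hR⟩ with hT
  set P := (W.torsionPointsEquiv ((2 ^ k : ℕ) : ℤ) (E := v.adicCompletion K) hn).symm T with hP
  have hPT : W.torsionPointsEquiv ((2 ^ k : ℕ) : ℤ) (E := v.adicCompletion K) hn P = T := by
    rw [hP, AddEquiv.apply_symm_apply]
  have hfix : resGal (K := K) (v.adicCompletion K) τ • P = P :=
    AcSelmer.restrictField_torsionGaloisModule_apply_of_mem_absInertia W 2 k h2v hv hτ P
  have h1 : τ • R = ((τ • T : AddSubgroup.torsionBy (localPoints W (v.adicCompletion K)) ((2 ^ k : ℕ) : ℤ)) :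
      localPoints W (v.adicCompletion K)) := rfl
  rw [h1, ← hPT, ← torsionPointsEquiv_smul, hfix, hPT]

/-! ## §19 The twist has no `K_v`-rational point of order `4` at a ramified good odd place -/

/-- **A `Γ_{K_v}`-fixed point `Q` of `E^{(d)}(K̄_v)` killed by `4` is killed by `2`**, at a good place `v ∤ 2` of `W` that is
RAMIFIED in `K(√d)` (`ι(√d) ∉ K_v^{nr}`): with the signed local untwisting `θ` (p620927), `R = θ(Q) ∈ W(K̄_v)[4]` satisfies
`χ(σ)·σR = R` for all `σ`, the inertia fixes `R` (§18), and an inertia element `τ₀` with `χ(τ₀) = −1` (§17) gives `R = −R`.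
So `E^{(d)}(K_v)[2^∞] = E^{(d)}(K_v)[2]` — step one of Mazur–Rubin's Lemma 2.11. [cite: MazurRubin2010, Lemma 2.11] -/
theorem two_zsmul_eq_zero_of_fixed_of_four_zsmul_eq_zero [W.IsElliptic] {d : K} (hd : d ≠ 0)
    {C : VariableChange K} (hWd : C • W.quadraticTwist d = Wd) (hv : W.HasGoodReductionAt v)
    (h2v : ((2 : ℕ) : 𝓞 K) ∉ v.asIdeal)
    (hram : closureEmb (K := K) (v.adicCompletion K) (geomSqrt d) ∉ maxUnramified (v.adicCompletion K))
    {Q : localPoints Wd (v.adicCompletion K)}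
    (hQ : ∀ σ : absoluteGaloisGroup (v.adicCompletion K), σ • Q = Q) (h4 : ((2 ^ 2 : ℕ) : ℤ) • Q = 0) :
    (2 : ℤ) • Q = 0 := by
  haveI : NeZero (2 : K) := ⟨two_ne_zero⟩
  obtain ⟨ψ, -, hloc⟩ := exists_addEquiv_geomTorsion_two_localSquare_signed W hd hWd
  obtain ⟨θ, hfix, hneg, -, -⟩ := hloc (v.adicCompletion K)
  have hx2 : (closureEmb (K := K) (v.adicCompletion K) (geomSqrt d)) ^ 2 =
      algebraMap K (AlgebraicClosure (v.adicCompletion K)) d := by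
    rw [← map_pow, geomSqrt_sq, AlgHom.commutes]
  obtain ⟨τ₀, hτ₀I, hτ₀⟩ := exists_mem_absInertia_smul_eq_neg v hx2 hram
  have hR4 : ((2 ^ 2 : ℕ) : ℤ) • θ Q = 0 := by rw [← map_zsmul, h4, map_zero]
  have hRfix : τ₀ • θ Q = θ Q := smul_eq_self_of_mem_absInertia_of_zsmul_eq_zero W v hv h2v 2 hτ₀I hR4
  have hRneg : θ Q = -(τ₀ • θ Q) := by rw [← hneg τ₀ hτ₀ Q, hQ τ₀]
  rw [hRfix] at hRneg
  have h2R : (2 : ℤ) • θ Q = 0 := by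
    rw [two_zsmul]
    nth_rewrite 1 [hRneg]
    exact neg_add_cancel _
  apply θ.injective
  rw [map_zsmul, h2R, map_zero]

end Summit.BirchSwinnertonDyer.BirchSwinnertonDyer.Theorems.GenusKolyTwistLocal

end
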